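import Literature.Computability.MetaComplexity.DistProblemsProofs
import Literature.Computability.MetaComplexity.SchemeEncBricks
import Literature.Computability.Complexity.LoopUntilFlag
import Literature.Computability.Complexity.FPStringBricks
import Literature.Computability.Complexity.PRelHierarchy
import Mathlib.Analysis.SpecialFunctions.Pow.Real
import HarnessLib

/-!
# Errorless heuristic schemes yield Levin's average polynomial time: `AvgP ⊆ AvgPLevin`

Topic `Literature/Computability/MetaComplexity`, second half of the discharge of the named fact
`Literature.Computability.MetaComplexity.mem_AvgP_iff_mem_AvgPLevin` (`DistProblems.lean`;
Bogdanov–Trevisan 2006, §2.2.1, Prop. 7 of arXiv cs/0606037v2; Impagliazzo 1995, Prop. 2), for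
ensembles with polynomially bounded support lengths (`Ensemble.HasPolyLength`, Bogdanov–Trevisan's
standing convention `|x| ≤ poly(n)`):

* `mem_AvgPLevin_of_mem_AvgP : Q.dist.HasPolyLength → Q ∈ AvgP → Q ∈ AvgPLevin`.

The printed proof: "On input `(x; n)`, simulate `A(x; n; 1/2)`; if `A(x; n; 1/2) ≠ ⊥` return its
output, otherwise simulate `A(x; n; 1/4)`, and so on … until we reach a value of `δ` such that
`A(x; n; δ) ≠ ⊥`. Eventually the algorithm succeeds, because when `δ < Dₙ(x)` then `A(x; n; δ)`
cannot output `⊥`. After `k` iterations, `A` uses time `Σᵢ₌₁ᵏ p(2ⁱ n) = O(k · p(2ᵏ n))`, and it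
halts within `k` iterations on all but a `1/2ᵏ` fraction of inputs. It is now easy to verify that
`A` runs in average polynomial time" (Bogdanov–Trevisan, proof of Prop. 7; the last step is the
tail-sum computation of the proof of Prop. 5, `𝔼[t^λ] ≤ n + Σ_t Pr[t_A ≥ t^{1/λ}]`).

## The proof in the tree's machine model

* **The loop** is the machine `TM2Until.untilAux` of `LoopUntilFlag.lean` (repeat a machine on its
  tagged output until the flag `1`, running time = the sum of the round times) applied to the
  round function `searchF A ∈ FP` (`searchF_mem_FP`): on `0⟨x, 1ⁿ⟩` it forms the state
  `⟨x, ⟨1ⁿ, 1¹⟩⟩` (`firstS`), on `1s` it doubles the last field of the state `s = ⟨x, ⟨1ⁿ, 1ᵐ⟩⟩`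
  (`dblS`), and then runs the scheme (`roundG`): `1b` if `A(x; 1ⁿ, 1ᵐ) = b ∈ {0,1}`, `0s` if it is
  `⊥` — the scheme being available as a total `FP` function on all words through the normaliser
  of `SchemeEncBricks.lean` (`schemeOptFn_mem_FP`). Its orbit on `⟨x, 1ⁿ⟩` visits the states
  `⟨x, ⟨1ⁿ, 1^{2ʲ}⟩⟩` (`out_searchF`) until the first `J` with `A(x; 1ⁿ, 1^{2ᴶ}) ≠ ⊥`, which exists
  on the support (`exists_ne_none_of_mem_support`: `Dₙ(x) ≤ Pr[A(·; 1ⁿ, 1ᵐ) = ⊥] ≤ 1/m` is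
  impossible for all `m = 2ʲ`), and then outputs `[A(x; 1ⁿ, 1^{2ᴶ})] = [L(x)]` (errorlessness);
  its running time is at most `R(2|x| + 2n + 5 + 2ᴶ)` for a polynomial `R` (`search_outputsWithin`:
  `J + 1 ≤ 2ᴶ` rounds of cost `≤ p_F(W) + 2W + 1`, `W = 2|x| + 2n + 5 + 2ᴶ`).
* **The average.** With `|x| ≤ q(n)` on the support, the time is `T(x, n) = R(W_q(n) + 2^{J(x)})`,
  bounded by `(α (n+1) 2^{J+1})^δ` (`exists_monomial_bound`), so for `ε = 1/(2δ)`,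
  `T(x,n)^ε ≤ 2α(n+1) · √2^{J(x)}` (`rpow_time_le`); and since `Pr_{x∼Dₙ}[J(x) ≥ j+1] ≤
  Pr[A(·; 1ⁿ, 1^{2ʲ}) = ⊥] ≤ 2^{-j}`, the layer-cake bound `√2^J ≤ 1 + Σ_{j+1 ≤ J} √2^{j+1}` gives
  `𝔼[√2^{J}] ≤ 1 + √2 · Σⱼ (√2/2)ʲ < ∞` (`tsum_mul_pow_le_of_tail`, in `ℝ≥0∞` with
  `ENNReal.tsum_geometric`), whence `𝔼_{x∼Dₙ}[T(x,n)^ε] ≤ c·n + c`.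

## References

* A. Bogdanov, L. Trevisan, *Average-Case Complexity*, Found. Trends TCS 2 (2006) 1–106,
  §2.2.1: arXiv cs/0606037v2 Def. 3, Def. 4, Prop. 5 (proof), Def. 6, Prop. 7 (proof, second
  paragraph: the doubling loop), Def. 8. doi:10.1561/0400000004
* R. Impagliazzo, *A personal view of average-case complexity*, Structure in Complexity Theory
  1995, §2, Prop. 2 (p. 11: "simulates `B` with parameters `δ = 1/2, 1/4, 1/8, …` until an answer
  is given … the expectation of the `1/2c` power of the time … is `O(n^{1/2})`").
  doi:10.1109/sct.1995.514853
* S. Arora, B. Barak, *Computational Complexity: A Modern Approach*, CUP 2009, §1.3 (machines as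
  subroutines), §18.1 (Def. 18.4).
-/

namespace Literature.Computability.MetaComplexity

open _root_.Computability Complexity Complexity.Classes Turing Polynomial
open scoped ENNReal

/-! ### The round function of the doubling search -/

section Round

variable (A : List Bool → ℕ → ℕ → Option Bool)

/-- The total string function of a `{0, 1, ⊥}`-valued scheme `A(x; 1ᵗ, 1ᵐ)`:
`schemeOptFn A w = optBoolEnc (A x t m)` for `(x, t, m) = decScheme w` (so arbitrary words are
accepted; cf. `schemeFn` for Boolean schemes). [folklore] -/
noncomputable def schemeOptFn (w : List Bool) : List Bool :=
  optBoolEnc (A (decScheme w).1 (decScheme w).2.1 (decScheme w).2.2)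

/-- On well-formed words `schemeOptFn A` is the scheme. [folklore] -/
@[simp] theorem schemeOptFn_schemeEnc (x : List Bool) (t m : ℕ) :
    schemeOptFn A (schemeEnc (x, t, m)) = optBoolEnc (A x t m) := by
  simp [schemeOptFn]

/-- **A scheme-specified polynomial-time `{0,1,⊥}`-valued algorithm is a total `FP` function**:
decode-and-normalise (`polyTimeComputable_decScheme`), then run `A` (`PolyTimeComputable.comp_holds`).
[cite: AroraBarak2009, §1.3 (composition)] -/
theorem schemeOptFn_mem_FP
    (hA : PolyTimeComputable schemeEnc optBoolEnc fun q : List Bool × ℕ × ℕ => A q.1 q.2.1 q.2.2) :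
    schemeOptFn A ∈ FP := by
  obtain ⟨p, M, hM⟩ := PolyTimeComputable.comp_holds hA polyTimeComputable_decScheme
  exact ⟨p, M, fun w => hM w⟩

/-- **One round of the doubling search on a state** `s = ⟨x, ⟨1ⁿ, 1ᵐ⟩⟩`: run the scheme; if it
answers `b ∈ {0,1}` (output word `1b`) emit `1b` — flag up, answer `b` —, if it answers `⊥`
(output word `0`) emit `0s` — flag down, keep the state. As a brick term: branch on the first
symbol of the scheme's output. [cite: BogdanovTrevisan2006, §2.2.1, Prop. 7 (proof: "if A(x;n;δ) ≠ ⊥ then return the output"; arXiv cs/0606037v2)] -/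
noncomputable def roundG : List Bool → List Bool :=
  iteFn (take1Fn ∘ schemeOptFn A) (schemeOptFn A) (List.cons false)

/-- The round on a state, by cases on the scheme's answer. [folklore] -/
theorem roundG_schemeEnc (x : List Bool) (n m : ℕ) :
    roundG A (schemeEnc (x, n, m)) =
      match A x n m with
      | some b => [true, b]
      | none => false :: schemeEnc (x, n, m) := by
  unfold roundG
  cases h : A x n m with
  | none =>
    rw [iteFn_apply_false (by simp [take1Fn, h, optBoolEnc, Encoding.optionBool])]
  | some b =>
    rw [iteFn_apply_true (by simp [take1Fn, h, optBoolEnc, Encoding.optionBool])]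
    simp [h, optBoolEnc, Encoding.optionBool, encodingBoolBool, encodeBool]

/-- `roundG A ∈ FP` for a polynomial-time scheme. [cite: AroraBarak2009, §1.3] -/
theorem roundG_mem_FP
    (hA : PolyTimeComputable schemeEnc optBoolEnc fun q : List Bool × ℕ × ℕ => A q.1 q.2.1 q.2.2) :
    roundG A ∈ FP :=
  iteFn_mem_FP (comp_mem_FP take1Fn_mem_FP (schemeOptFn_mem_FP A hA)) (schemeOptFn_mem_FP A hA)
    (cons_mem_FP false)

/-- The first state: `⟨x, 1ⁿ⟩ ↦ ⟨x, ⟨1ⁿ, 1¹⟩⟩` (error parameter `δ = 1/1`, doubled before it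
matters). [folklore] -/
noncomputable def firstS : List Bool → List Bool := pairFn fstP (pairFn sndP fun _ => [true])

/-- `firstS ⟨x, 1ⁿ⟩ = ⟨x, ⟨1ⁿ, 1¹⟩⟩`. [folklore] -/
theorem firstS_paramEnc (x : List Bool) (n : ℕ) : firstS (paramEnc (x, n)) = schemeEnc (x, n, 1) := by
  simp [firstS, paramEnc, schemeEnc]
  rfl

/-- `firstS ∈ FP`. [cite: AroraBarak2009, §1.3] -/
theorem firstS_mem_FP : firstS ∈ FP :=
  pairFn_mem_FP fstP_mem_FP (pairFn_mem_FP sndP_mem_FP (const_mem_FP _))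

/-- Doubling the error parameter: `⟨x, ⟨1ⁿ, 1ᵐ⟩⟩ ↦ ⟨x, ⟨1ⁿ, 1²ᵐ⟩⟩`. [cite: BogdanovTrevisan2006, §2.2.1, Prop. 7 (proof: δ = 1/2, 1/4, 1/8, …; arXiv cs/0606037v2)] -/
noncomputable def dblS : List Bool → List Bool :=
  pairFn fstP (pairFn (fstP ∘ sndP) ((fun u => id u ++ id u) ∘ sndP ∘ sndP))

/-- `dblS ⟨x, ⟨1ⁿ, 1ᵐ⟩⟩ = ⟨x, ⟨1ⁿ, 1²ᵐ⟩⟩`. [folklore] -/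
theorem dblS_schemeEnc (x : List Bool) (n m : ℕ) :
    dblS (schemeEnc (x, n, m)) = schemeEnc (x, n, 2 * m) := by
  simp [dblS, schemeEnc, OracleCompose.unaryEncodeNat_eq_replicate, two_mul]

/-- `dblS ∈ FP`. [cite: AroraBarak2009, §1.3] -/
theorem dblS_mem_FP : dblS ∈ FP :=
  pairFn_mem_FP fstP_mem_FP (pairFn_mem_FP (comp_mem_FP fstP_mem_FP sndP_mem_FP)
    (comp_mem_FP (append_mem_FP OracleCompose.id_mem_FP OracleCompose.id_mem_FP)
      (comp_mem_FP sndP_mem_FP sndP_mem_FP)))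

/-- **The round function of the doubling search** (the function iterated by the loop machine):
on the first word `0⟨x, 1ⁿ⟩` form the first state and run a round; on a later word `1s` double
the error parameter of the state `s` and run a round. [cite: BogdanovTrevisan2006, §2.2.1, Prop. 7 (proof; arXiv cs/0606037v2)] -/
noncomputable def searchF : List Bool → List Bool :=
  iteFn take1Fn (roundG A ∘ dblS ∘ List.tail) (roundG A ∘ firstS ∘ List.tail)

/-- The first round. [folklore] -/
theorem searchF_false (w : List Bool) : searchF A (false :: w) = roundG A (firstS w) := by
  unfold searchF
  rw [iteFn_apply_false (show take1Fn (false :: w) = [false] from rfl)]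
  rfl

/-- A later round. [folklore] -/
theorem searchF_true (s : List Bool) : searchF A (true :: s) = roundG A (dblS s) := by
  unfold searchF
  rw [iteFn_apply_true (show take1Fn (true :: s) = [true] from rfl)]
  rfl

/-- **`searchF A ∈ FP`** for a polynomial-time scheme. [cite: AroraBarak2009, §1.3] -/
theorem searchF_mem_FP
    (hA : PolyTimeComputable schemeEnc optBoolEnc fun q : List Bool × ℕ × ℕ => A q.1 q.2.1 q.2.2) :
    searchF A ∈ FP :=
  iteFn_mem_FP take1Fn_mem_FP
    (comp_mem_FP (roundG_mem_FP A hA) (comp_mem_FP dblS_mem_FP PRelSigma.tail_mem_FP))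
    (comp_mem_FP (roundG_mem_FP A hA) (comp_mem_FP firstS_mem_FP PRelSigma.tail_mem_FP))

/-- **The orbit of the doubling search.** As long as the scheme has answered `⊥` at the error
parameters `1, 1/2, …, 1/2^{j-1}`, round `j` of the loop is the round on the state
`⟨x, ⟨1ⁿ, 1^{2ʲ}⟩⟩`, fed (for `j ≥ 1`) the word `1⟨x, ⟨1ⁿ, 1^{2^{j-1}}⟩⟩`.
[cite: BogdanovTrevisan2006, §2.2.1, Prop. 7 (proof; arXiv cs/0606037v2)] -/
theorem out_searchF (x : List Bool) (n : ℕ) : ∀ j : ℕ, (∀ i < j, A x n (2 ^ i) = none) →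
    TM2Until.out (searchF A) (paramEnc (x, n)) j = roundG A (schemeEnc (x, n, 2 ^ j)) ∧
      (∀ i, j = i + 1 → TM2Until.fed (searchF A) (paramEnc (x, n)) j = true :: schemeEnc (x, n, 2 ^ i)) := by
  intro j
  induction j with
  | zero =>
    intro _
    refine ⟨?_, fun i hi => absurd hi (by omega)⟩
    rw [TM2Until.out_eq, TM2Until.fed_zero, searchF_false, firstS_paramEnc, pow_zero]
  | succ j ih =>
    intro hnone
    obtain ⟨hout, -⟩ := ih fun i hi => hnone i (by omega)
    have htail : (TM2Until.out (searchF A) (paramEnc (x, n)) j).tail = schemeEnc (x, n, 2 ^ j) := by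
      rw [hout, roundG_schemeEnc, hnone j (by omega)]
      rfl
    have hfed : TM2Until.fed (searchF A) (paramEnc (x, n)) (j + 1) = true :: schemeEnc (x, n, 2 ^ j) := by
      rw [TM2Until.fed_succ, htail]
    refine ⟨?_, fun i hi => ?_⟩
    · rw [TM2Until.out_eq, hfed, searchF_true, dblS_schemeEnc, ← pow_succ']
    · obtain rfl : j = i := by omega
      exact hfed

/-- `|⟨x, 1ⁿ⟩| = 2|x| + n + 2` (private copy of the lemma of
`HeuristicClassesHeurBPPReductionProofs.lean`, whose import closure is not wanted here). [folklore] -/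
private theorem length_paramEnc_eq (x : List Bool) (n : ℕ) : (paramEnc (x, n)).length = 2 * x.length + n + 2 := by
  simp only [paramEnc, length_boolPair, OracleCompose.unaryEncodeNat_eq_replicate, List.length_replicate]
  omega

/-- `|⟨x, ⟨1ᵗ, 1ᵐ⟩⟩| = 2|x| + 2t + m + 4` (private copy, as above). [folklore] -/
private theorem length_schemeEnc_eq (x : List Bool) (t m : ℕ) :
    (schemeEnc (x, t, m)).length = 2 * x.length + 2 * t + m + 4 := by
  simp only [schemeEnc, length_boolPair, OracleCompose.unaryEncodeNat_eq_replicate,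
    List.length_replicate]
  omega

end Round

/-! ### The loop machine on one input: output and running time -/

section Search

variable {A : List Bool → ℕ → ℕ → Option Bool} (Mx : TM2ComputableAux Bool Bool) (pF : Polynomial ℕ)
  (hMx : ∀ u, Mx.OutputsWithin u (searchF A u) (pF.eval u.length))

/-- The running-time polynomial of the doubling search in terms of the time polynomial `p` of
its round function: `(W + 1)(p(W) + 2W + 3)`, evaluated at `W = 2|x| + 2n + 5 + 2ᴶ`.
[folklore] -/
noncomputable def searchPoly (p : Polynomial ℕ) : Polynomial ℕ := (X + 1) * (p + 2 * X + 3)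

/-- Evaluation of `searchPoly`. [folklore] -/
theorem searchPoly_eval (p : Polynomial ℕ) (W : ℕ) :
    (searchPoly p).eval W = (W + 1) * (p.eval W + 2 * W + 3) := by
  simp [searchPoly]

include hMx in
/-- **The doubling search on one input.** If the scheme answers `⊥` at the error parameters
`1, …, 1/2^{J-1}` and `b` at `1/2ᴶ`, then the loop machine `untilAux Mx` of the round function
outputs `[b]` on `⟨x, 1ⁿ⟩` within `searchPoly p_F (2|x| + 2n + 5 + 2ᴶ)` steps: by
`TM2Until.untilAux_outputsWithin` there are `J + 1 ≤ 2ᴶ` rounds, each fed a word of length `≤ W`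
with an output of length `≤ W`, `W = 2|x| + 2n + 5 + 2ᴶ`, hence of cost `≤ p_F(W) + 2W + 1`
("after `k` iterations, `A` uses time `Σᵢ p(2ⁱ n) = O(k p(2ᵏ n))`").
[cite: BogdanovTrevisan2006, §2.2.1, Prop. 7 (proof; arXiv cs/0606037v2)] -/
theorem search_outputsWithin (x : List Bool) (n J : ℕ) (b : Bool)
    (hnone : ∀ i < J, A x n (2 ^ i) = none) (hsome : A x n (2 ^ J) = some b) :
    (TM2Until.untilAux Mx).OutputsWithin (paramEnc (x, n)) [b]
      ((searchPoly pF).eval (2 * x.length + 2 * n + 5 + 2 ^ J)) := by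
  -- the power of two as an atom (for linear arithmetic)
  obtain ⟨PJ, hPJ⟩ : ∃ PJ, 2 ^ J = PJ := ⟨_, rfl⟩
  have hPJ1 : J + 1 ≤ PJ := by rw [← hPJ]; exact Nat.lt_two_pow_self
  have hpow : ∀ j ≤ J, 2 ^ j ≤ PJ := fun j hj => by
    rw [← hPJ]; exact Nat.pow_le_pow_right (by norm_num) hj
  set W : ℕ := 2 * x.length + 2 * n + 5 + PJ with hW
  -- the orbit: states, fed words, outputs, and their lengths
  have horb : ∀ j ≤ J, TM2Until.out (searchF A) (paramEnc (x, n)) j = roundG A (schemeEnc (x, n, 2 ^ j)) :=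
    fun j hj => (out_searchF A x n j fun i hi => hnone i (by omega)).1
  have hcont : ∀ j < J, ∃ s, TM2Until.out (searchF A) (paramEnc (x, n)) j = false :: s := by
    intro j hj
    refine ⟨schemeEnc (x, n, 2 ^ j), ?_⟩
    rw [horb j hj.le, roundG_schemeEnc, hnone j hj]
  have hhalt : TM2Until.out (searchF A) (paramEnc (x, n)) J = true :: [b] := by
    rw [horb J le_rfl, roundG_schemeEnc, hsome]
  have hlenS : ∀ j ≤ J, (schemeEnc (x, n, 2 ^ j)).length + 1 ≤ W := by
    intro j hj
    have h2 := hpow j hj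
    rw [length_schemeEnc_eq, hW]
    omega
  have hfed : ∀ j ≤ J, (TM2Until.fed (searchF A) (paramEnc (x, n)) j).length ≤ W := by
    intro j hj
    cases j with
    | zero =>
      rw [TM2Until.fed_zero, List.length_cons, length_paramEnc_eq, hW]
      omega
    | succ i =>
      rw [(out_searchF A x n (i + 1) fun k hk => hnone k (by omega)).2 i rfl, List.length_cons]
      exact hlenS i (by omega)
  have hout : ∀ j ≤ J, (TM2Until.out (searchF A) (paramEnc (x, n)) j).length ≤ W := by
    intro j hj
    rcases hj.lt_or_eq with hlt | rfl
    · rw [horb j hj, roundG_schemeEnc, hnone j hlt]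
      show (false :: schemeEnc (x, n, 2 ^ j)).length ≤ W
      rw [List.length_cons]
      exact hlenS j hj
    · rw [hhalt]
      show 2 ≤ W
      omega
  -- the loop machine
  have hrun := TM2Until.untilAux_outputsWithin Mx hMx (paramEnc (x, n)) J [b] hcont hhalt
  rw [hPJ]
  refine hrun.mono ?_
  -- the cost of the rounds
  have hcost : ∀ j ∈ Finset.range (J + 1),
      TM2Until.roundCost (searchF A) (fun u => pF.eval u.length) (paramEnc (x, n)) j ≤
        pF.eval W + 2 * W + 1 := by
    intro j hj
    have hj' : j ≤ J := Nat.lt_succ_iff.1 (Finset.mem_range.1 hj)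
    simp only [TM2Until.roundCost]
    have h1 := TM2Iter.eval_mono pF (hfed j hj')
    have h2 := hout j hj'
    omega
  have hsum := Finset.sum_le_sum hcost
  rw [Finset.sum_const, Finset.card_range, smul_eq_mul] at hsum
  have hJ : J + 1 ≤ W := by rw [hW]; omega
  have hx2 : 2 * (paramEnc (x, n)).length + 3 ≤ 2 * W := by
    rw [length_paramEnc_eq, hW]
    omega
  rw [searchPoly_eval]
  calc 2 * (paramEnc (x, n)).length + 3 +
        ∑ j ∈ Finset.range (J + 1), TM2Until.roundCost (searchF A) (fun u => pF.eval u.length) (paramEnc (x, n)) j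
      ≤ 2 * W + (J + 1) * (pF.eval W + 2 * W + 1) := Nat.add_le_add hx2 hsum
    _ ≤ 2 * W + W * (pF.eval W + 2 * W + 1) := by gcongr
    _ ≤ (W + 1) * (pF.eval W + 2 * W + 3) := by nlinarith

end Search

/-! ### The first success index exists on the support -/

/-- An ensemble's probability is at most one, in `ℝ≥0∞`. [folklore] -/
theorem toOuterMeasure_le_one' (D : Ensemble) (n : ℕ) (E : Set (List Bool)) :
    (D n).toOuterMeasure E ≤ 1 := by
  rw [← (PMF.toOuterMeasure_apply_eq_one_iff (D n) Set.univ).2 (Set.subset_univ _)]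
  exact (D n).toOuterMeasure_mono fun _ _ => Set.mem_univ _

/-- A real bound on `Ensemble.prob` is an `ℝ≥0∞` bound on the outer measure. [folklore] -/
theorem toOuterMeasure_le_ofReal_of_prob_le (D : Ensemble) (n : ℕ) {E : Set (List Bool)} {r : ℝ}
    (hr : 0 ≤ r) (h : D.prob n E ≤ r) : (D n).toOuterMeasure E ≤ ENNReal.ofReal r :=
  (ENNReal.le_ofReal_iff_toReal_le (ne_top_of_le_ne_top ENNReal.one_ne_top
    (toOuterMeasure_le_one' D n E)) hr).2 h

/-- The mass of a point is at most the probability of any event containing it. [folklore] -/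
theorem apply_toReal_le_prob (D : Ensemble) (n : ℕ) {E : Set (List Bool)} {x : List Bool}
    (hx : x ∈ E) : (D n x).toReal ≤ D.prob n E := by
  unfold Ensemble.prob
  refine ENNReal.toReal_mono (ne_top_of_le_ne_top ENNReal.one_ne_top (toOuterMeasure_le_one' D n E)) ?_
  rw [← PMF.toOuterMeasure_apply_singleton]
  exact (D n).toOuterMeasure_mono fun y hy => by
    obtain ⟨rfl, -⟩ := hy
    exact hx

/-- **On the support the doubling search terminates**: if `Pr_{x∼Dₙ}[A(x; 1ⁿ, 1ᵐ) = ⊥] ≤ 1/m`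
for all `m > 0`, then every `x ∈ supp Dₙ` has some `j` with `A(x; 1ⁿ, 1^{2ʲ}) ≠ ⊥` ("when
`δ < Dₙ(x)` then `A(x; n; δ)` cannot output `⊥`"). [cite: BogdanovTrevisan2006, §2.2.1, Prop. 7 (proof; arXiv cs/0606037v2)] -/
theorem exists_ne_none_of_mem_support {A : List Bool → ℕ → ℕ → Option Bool} {D : Ensemble} {n : ℕ}
    (hfail : ∀ m, 0 < m → D.prob n {x | A x n m = none} ≤ 1 / m) {x : List Bool}
    (hx : x ∈ (D n).support) : ∃ j, A x n (2 ^ j) ≠ none := by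
  by_contra h
  simp only [ne_eq, not_exists, not_not] at h
  have hpos : 0 < (D n x).toReal :=
    ENNReal.toReal_pos ((PMF.mem_support_iff _ _).1 hx)
      (ne_top_of_le_ne_top ENNReal.one_ne_top (PMF.coe_le_one _ _))
  obtain ⟨j, hj⟩ := exists_pow_lt_of_lt_one hpos (by norm_num : (1 / 2 : ℝ) < 1)
  have h1 : (D n x).toReal ≤ 1 / 2 ^ j := by
    have := (apply_toReal_le_prob D n (E := {x | A x n (2 ^ j) = none}) (h j)).trans
      (hfail (2 ^ j) (pow_pos two_pos j))
    simpa using this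
  rw [one_div_pow] at hj
  exact absurd (h1.trans_lt hj) (lt_irrefl _)

/-! ### The average of a power of the running time -/

/-- **A polynomial of a polynomial plus a power of two is a monomial in `(n+1) 2^{J+1}`**: for
polynomials `R`, `Wq` there are `α, δ ≥ 1` with `R(Wq(n) + 2ᴶ) ≤ (α (n+1) 2^{J+1})^δ`.
[folklore] -/
theorem exists_monomial_bound (R Wq : Polynomial ℕ) :
    ∃ α δ : ℕ, 1 ≤ α ∧ 1 ≤ δ ∧ ∀ n J : ℕ, R.eval (Wq.eval n + 2 ^ J) ≤ (α * (n + 1) * 2 ^ (J + 1)) ^ δ := by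
  obtain ⟨a, d, ha⟩ := exists_eval_le_mul_pow_add R
  obtain ⟨a', d', ha'⟩ := exists_eval_le_mul_pow_add Wq
  -- the constants
  set c₁ : ℕ := 2 * (a + 1) with hc₁
  set c₂ : ℕ := 2 * a' + 2 with hc₂
  have hc : 1 ≤ c₁ * c₂ := Nat.mul_pos (by omega) (by omega)
  refine ⟨c₁ * c₂, (d + 1) * (d' + 1), hc, Nat.mul_pos (Nat.succ_pos _) (Nat.succ_pos _),
    fun n J => ?_⟩
  set y := Wq.eval n + 2 ^ J with hy
  set N1 : ℕ := (n + 1) ^ (d' + 1) with hN1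
  set P2 : ℕ := 2 ^ J with hP2
  have hN1' : 1 ≤ N1 := Nat.one_le_pow _ _ (Nat.succ_pos n)
  have hP2' : 1 ≤ P2 := Nat.one_le_two_pow
  -- `R y ≤ c₁ (y+1)^(d+1)`
  have h1 : R.eval y ≤ c₁ * (y + 1) ^ (d + 1) := by
    have e1 : y ^ d ≤ (y + 1) ^ (d + 1) :=
      (Nat.pow_le_pow_left (Nat.le_succ y) d).trans (Nat.pow_le_pow_right (Nat.succ_pos y) (Nat.le_succ d))
    have e2 : 1 ≤ (y + 1) ^ (d + 1) := Nat.one_le_pow _ _ (Nat.succ_pos y)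
    have e3 := ha y
    have e4 : a * y ^ d ≤ a * (y + 1) ^ (d + 1) := Nat.mul_le_mul_left a e1
    rw [hc₁]
    nlinarith
  -- `y + 1 ≤ c₂ N1 (2 P2)`
  have h2 : y + 1 ≤ c₂ * (N1 * (P2 * 2)) := by
    have e1 : n ^ d' ≤ N1 :=
      (Nat.pow_le_pow_left (Nat.le_succ n) d').trans (Nat.pow_le_pow_right (Nat.succ_pos n) (Nat.le_succ d'))
    have e4 : a' * n ^ d' ≤ a' * N1 := Nat.mul_le_mul_left a' e1
    have hy1 : y + 1 ≤ 2 * a' * N1 + (P2 + 1) := by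
      have := ha' n
      have e5 : a' ≤ a' * N1 := Nat.le_mul_of_pos_right _ hN1'
      have e6 : 2 * a' * N1 = 2 * (a' * N1) := by ring
      rw [hy, e6]
      omega
    have g1 : N1 ≤ N1 * (P2 * 2) := Nat.le_mul_of_pos_right _ (by omega)
    have g2 : P2 + 1 ≤ N1 * (P2 * 2) :=
      calc P2 + 1 ≤ P2 * 2 := by omega
        _ ≤ N1 * (P2 * 2) := Nat.le_mul_of_pos_left _ (by omega)
    calc y + 1 ≤ 2 * a' * N1 + (P2 + 1) := hy1
      _ ≤ 2 * a' * (N1 * (P2 * 2)) + 2 * (N1 * (P2 * 2)) :=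
          Nat.add_le_add (Nat.mul_le_mul_left (2 * a') g1) (by omega)
      _ = c₂ * (N1 * (P2 * 2)) := by rw [hc₂]; ring
  -- `N1 (2 P2) ≤ ((n+1) 2^(J+1))^(d'+1)`
  have hQ : N1 * (P2 * 2) ≤ ((n + 1) * 2 ^ (J + 1)) ^ (d' + 1) := by
    rw [mul_pow, hN1, hP2, ← pow_succ]
    exact Nat.mul_le_mul_left _ (Nat.le_self_pow (by omega) _)
  -- combine
  calc R.eval y ≤ c₁ * (y + 1) ^ (d + 1) := h1
    _ ≤ c₁ * (c₂ * (N1 * (P2 * 2))) ^ (d + 1) := Nat.mul_le_mul_left _ (Nat.pow_le_pow_left h2 _)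
    _ = c₁ * c₂ ^ (d + 1) * (N1 * (P2 * 2)) ^ (d + 1) := by rw [mul_pow]; ring
    _ ≤ (c₁ * c₂) ^ (d + 1) * (N1 * (P2 * 2)) ^ (d + 1) := by
        refine Nat.mul_le_mul_right _ ?_
        rw [mul_pow]
        exact Nat.mul_le_mul_right _ (Nat.le_self_pow (by omega) _)
    _ ≤ (c₁ * c₂) ^ ((d + 1) * (d' + 1)) * (((n + 1) * 2 ^ (J + 1)) ^ (d' + 1)) ^ (d + 1) :=
        Nat.mul_le_mul (Nat.pow_le_pow_right hc (Nat.le_mul_of_pos_right _ (Nat.succ_pos _)))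
          (Nat.pow_le_pow_left hQ _)
    _ = (c₁ * c₂ * (n + 1) * 2 ^ (J + 1)) ^ ((d + 1) * (d' + 1)) := by
        rw [← pow_mul, Nat.mul_comm (d' + 1) (d + 1), mul_assoc (c₁ * c₂), ← mul_pow]

/-- `√(2ᴶ) = √2ᴶ`. [folklore] -/
theorem sqrt_two_pow (J : ℕ) : Real.sqrt ((2 : ℝ) ^ J) = Real.sqrt 2 ^ J := by
  induction J with
  | zero => simp
  | succ J ih => rw [pow_succ, Real.sqrt_mul (by positivity), ih, pow_succ]

/-- **The power `ε = 1/(2δ)` of the running time**: if `t ≤ (α (n+1) 2^{J+1})^δ` with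
`α, δ ≥ 1` then `t^{1/(2δ)} ≤ 2α(n+1) · √2ᴶ`. [cite: BogdanovTrevisan2006, §2.2.1, Prop. 5 (proof: the exponent λ = ε/(c+2); arXiv cs/0606037v2)] -/
theorem rpow_time_le {α δ t n J : ℕ} (hα : 1 ≤ α) (hδ : 1 ≤ δ)
    (ht : t ≤ (α * (n + 1) * 2 ^ (J + 1)) ^ δ) :
    (t : ℝ) ^ (1 / (2 * δ : ℝ)) ≤ 2 * α * (n + 1) * Real.sqrt 2 ^ J := by
  have hδ0 : (0 : ℝ) < δ := by exact_mod_cast hδ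
  have hε : (0 : ℝ) ≤ 1 / (2 * δ) := by positivity
  set u : ℝ := ((α * (n + 1) * 2 ^ (J + 1) : ℕ) : ℝ) with hu
  have hu0 : (0 : ℝ) ≤ u := by positivity
  -- monotonicity of `rpow`, and `((u^δ))^(1/(2δ)) = √u`
  have h1 : (t : ℝ) ^ (1 / (2 * δ : ℝ)) ≤ Real.sqrt u := by
    have ht' : (t : ℝ) ≤ u ^ (δ : ℝ) := by
      rw [Real.rpow_natCast, hu]
      exact_mod_cast ht
    calc (t : ℝ) ^ (1 / (2 * δ : ℝ)) ≤ (u ^ (δ : ℝ)) ^ (1 / (2 * δ : ℝ)) :=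
          Real.rpow_le_rpow (Nat.cast_nonneg _) ht' hε
      _ = u ^ ((1 : ℝ) / 2) := by
          rw [← Real.rpow_mul hu0]
          congr 1
          field_simp
      _ = Real.sqrt u := (Real.sqrt_eq_rpow u).symm
  refine h1.trans ?_
  -- `√u = √(2α(n+1)) √(2ᴶ) ≤ 2α(n+1) √2ᴶ`
  have hsplit : u = (2 * α * (n + 1) : ℝ) * (2 : ℝ) ^ J := by
    rw [hu]; push_cast; ring
  rw [hsplit, Real.sqrt_mul (by positivity), sqrt_two_pow]
  gcongr
  rw [Real.sqrt_le_left (by positivity)]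
  have h1' : (1 : ℝ) ≤ 2 * α * (n + 1) := by
    have : (1 : ℝ) ≤ α := by exact_mod_cast hα
    nlinarith
  nlinarith

/-- **The layer-cake bound** (the tail-sum step of Bogdanov–Trevisan's proof of Prop. 5,
`𝔼[t^λ] ≤ n + Σ_t Pr[t_A ≥ t^{1/λ}]`, in geometric form): if `Pr_{x∼D}[J(x) ≥ j+1] ≤ 2^{-j}`
for all `j`, then `𝔼_{x∼D}[ρ^{J(x)}] ≤ 1 + ρ · Σⱼ (ρ/2)ʲ = 1 + ρ (1 - ρ/2)⁻¹` in `ℝ≥0∞`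
(from `ρ^J ≤ 1 + Σ_{j+1 ≤ J} ρ^{j+1}`, Fubini and the geometric series).
[cite: BogdanovTrevisan2006, §2.2.1, Prop. 5 (proof; arXiv cs/0606037v2)] -/
theorem tsum_mul_pow_le_of_tail (D : PMF (List Bool)) (Jf : List Bool → ℕ) (ρ : ℝ≥0∞)
    (htail : ∀ j : ℕ, D.toOuterMeasure {x | j + 1 ≤ Jf x} ≤ (ENNReal.ofReal (1 / 2)) ^ j) :
    ∑' x, D x * ρ ^ Jf x ≤ 1 + ρ * (1 - ρ * ENNReal.ofReal (1 / 2))⁻¹ := by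
  classical
  -- layer cake, pointwise
  have hlayer : ∀ N : ℕ, ρ ^ N ≤ 1 + ∑' j : ℕ, if j + 1 ≤ N then ρ ^ (j + 1) else 0 := by
    intro N
    cases N with
    | zero => simp
    | succ k =>
      refine le_add_left ?_
      refine le_trans ?_ (ENNReal.le_tsum k)
      rw [if_pos le_rfl]
  -- the tail probabilities as sums
  have hind : ∀ j : ℕ, ∑' x, D x * (if j + 1 ≤ Jf x then ρ ^ (j + 1) else 0) ≤
      ρ ^ (j + 1) * (ENNReal.ofReal (1 / 2)) ^ j := by
    intro j
    have e : ∀ x, D x * (if j + 1 ≤ Jf x then ρ ^ (j + 1) else 0) =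
        Set.indicator {x | j + 1 ≤ Jf x} D x * ρ ^ (j + 1) := by
      intro x
      by_cases hx : j + 1 ≤ Jf x
      · rw [if_pos hx, Set.indicator_of_mem (show x ∈ {x | j + 1 ≤ Jf x} from hx)]
      · rw [if_neg hx, Set.indicator_of_notMem (show x ∉ {x | j + 1 ≤ Jf x} from hx), mul_zero,
          zero_mul]
    simp_rw [e]
    rw [ENNReal.tsum_mul_right, ← PMF.toOuterMeasure_apply, mul_comm]
    gcongr
    exact htail j
  calc ∑' x, D x * ρ ^ Jf x
      ≤ ∑' x, D x * (1 + ∑' j : ℕ, if j + 1 ≤ Jf x then ρ ^ (j + 1) else 0) :=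
        ENNReal.tsum_le_tsum fun x => by gcongr; exact hlayer (Jf x)
    _ = ∑' x, (D x + D x * ∑' j : ℕ, if j + 1 ≤ Jf x then ρ ^ (j + 1) else 0) := by
        simp_rw [mul_add, mul_one]
    _ = 1 + ∑' x, ∑' j : ℕ, D x * (if j + 1 ≤ Jf x then ρ ^ (j + 1) else 0) := by
        rw [ENNReal.tsum_add, PMF.tsum_coe]
        simp_rw [ENNReal.tsum_mul_left]
    _ = 1 + ∑' j : ℕ, ∑' x, D x * (if j + 1 ≤ Jf x then ρ ^ (j + 1) else 0) := by
        rw [ENNReal.tsum_comm]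
    _ ≤ 1 + ∑' j : ℕ, ρ ^ (j + 1) * (ENNReal.ofReal (1 / 2)) ^ j :=
        add_le_add le_rfl (ENNReal.tsum_le_tsum hind)
    _ = 1 + ρ * (1 - ρ * ENNReal.ofReal (1 / 2))⁻¹ := by
        rw [← ENNReal.tsum_geometric, ← ENNReal.tsum_mul_left]
        congr 1
        refine tsum_congr fun j => ?_
        rw [pow_succ', mul_pow, mul_assoc]

/-- The geometric constant of the layer-cake bound is finite: `√2 / 2 < 1`. [folklore] -/
theorem layerCake_const_ne_top :
    (1 : ℝ≥0∞) + ENNReal.ofReal (Real.sqrt 2) *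
      (1 - ENNReal.ofReal (Real.sqrt 2) * ENNReal.ofReal (1 / 2))⁻¹ ≠ ⊤ := by
  refine ENNReal.add_ne_top.2 ⟨ENNReal.one_ne_top, ENNReal.mul_ne_top ENNReal.ofReal_ne_top ?_⟩
  refine ENNReal.inv_ne_top.2 ?_
  intro h
  rw [tsub_eq_zero_iff_le, ← ENNReal.ofReal_mul (Real.sqrt_nonneg _)] at h
  have hlt : Real.sqrt 2 * (1 / 2) < 1 := by
    have : Real.sqrt 2 < 2 := (Real.sqrt_lt' two_pos).2 (by norm_num)
    linarith
  have : ENNReal.ofReal (Real.sqrt 2 * (1 / 2)) < 1 := ENNReal.ofReal_lt_one.2 hlt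
  exact absurd h this.not_ge

/-! ### `AvgP ⊆ AvgPLevin` -/

/-- **An errorless heuristic scheme yields Levin's average polynomial time** (Bogdanov–Trevisan
2006, Prop. 7, second half of the proof, with the tail-sum step of Prop. 5; Impagliazzo 1995,
Prop. 2), for ensembles with polynomially bounded support lengths: if `(L, D) ∈ AvgP` and
`|x| ≤ q(n)` on `supp Dₙ`, then `(L, D) ∈ AvgPLevin`. The machine is the doubling search
(`TM2Until.untilAux` of `searchF A`); on `x ∈ supp Dₙ` it halts at the first `J` with
`A(x; 1ⁿ, 1^{2ᴶ}) ≠ ⊥` (`exists_ne_none_of_mem_support`) with the output `[L(x)]` (errorlessness)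
within `T(x, n) = R(W_q(n) + 2ᴶ)` steps (`search_outputsWithin`); and
`𝔼_{x∼Dₙ}[T(x,n)^ε] ≤ 2α(n+1) · 𝔼[√2^{J}] ≤ c n + c` for `ε = 1/(2δ)` (`exists_monomial_bound`,
`rpow_time_le`, `tsum_mul_pow_le_of_tail` with `Pr[J ≥ j+1] ≤ Pr[A(·; 1ⁿ, 1^{2ʲ}) = ⊥] ≤ 2^{-j}`).
[cite: BogdanovTrevisan2006, §2.2.1, Prop. 7 (arXiv cs/0606037v2; with Prop. 5)] -/
theorem mem_AvgPLevin_of_mem_AvgP {Q : DistProblem} (hlen : Q.dist.HasPolyLength) (h : Q ∈ AvgP) :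
    Q ∈ AvgPLevin := by
  classical
  obtain ⟨q, hq⟩ := hlen
  obtain ⟨A, hA, herr, hfail⟩ := h
  obtain ⟨pF, Mx, hMx⟩ := searchF_mem_FP A hA
  -- the time bound as a function of `n` and the first success index
  let Wq : Polynomial ℕ := 2 * q + 2 * X + 5
  obtain ⟨α, δ, hα, hδ, hmono⟩ := exists_monomial_bound (searchPoly pF) Wq
  let Jf : List Bool → ℕ → ℕ := fun x n => if h : ∃ j, A x n (2 ^ j) ≠ none then Nat.find h else 0
  let T : List Bool → ℕ → ℕ := fun x n =>
    if ∃ j, A x n (2 ^ j) ≠ none then (searchPoly pF).eval (Wq.eval n + 2 ^ Jf x n) else 0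
  -- the first success index
  have hJf : ∀ {x n}, (h : ∃ j, A x n (2 ^ j) ≠ none) →
      (∀ i < Jf x n, A x n (2 ^ i) = none) ∧ A x n (2 ^ Jf x n) ≠ none := by
    intro x n h
    have hJ : Jf x n = Nat.find h := dif_pos h
    refine ⟨fun i hi => ?_, by rw [hJ]; exact Nat.find_spec h⟩
    rw [hJ] at hi
    have := Nat.find_min h hi
    simpa using this
  refine ⟨TM2Until.untilAux Mx, T, fun n x hx => ?_, ?_⟩
  · -- on the support: halts with the right answer within `T x n` steps
    have hex : ∃ j, A x n (2 ^ j) ≠ none := exists_ne_none_of_mem_support (hfail n) hx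
    obtain ⟨hnone, hsucc⟩ := hJf hex
    obtain ⟨b, hb⟩ := Option.ne_none_iff_exists'.1 hsucc
    have hbL : b = Q.lang.boolIndicator x := herr _ n x hx b hb
    have hrun := search_outputsWithin Mx pF (fun u => hMx u) x n (Jf x n) b hnone hb
    rw [hbL] at hrun
    refine hrun.mono ?_
    show _ ≤ (if ∃ j, A x n (2 ^ j) ≠ none then (searchPoly pF).eval (Wq.eval n + 2 ^ Jf x n) else 0)
    rw [if_pos hex]
    refine TM2Iter.eval_mono _ (Nat.add_le_add_right ?_ _)
    have := hq n x hx
    simp only [Wq, eval_add, eval_mul, eval_ofNat, eval_X]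
    omega
  · -- the average of `T^ε`, `ε = 1/(2δ)`
    set ρ : ℝ≥0∞ := ENNReal.ofReal (Real.sqrt 2) with hρ
    set S : ℝ≥0∞ := 1 + ρ * (1 - ρ * ENNReal.ofReal (1 / 2))⁻¹ with hS
    have hSfin : S ≠ ⊤ := layerCake_const_ne_top
    obtain ⟨s, hs⟩ : ∃ s : ℕ, S ≤ s :=
      ⟨⌈S.toReal⌉₊,
        calc S = ENNReal.ofReal S.toReal := (ENNReal.ofReal_toReal hSfin).symm
          _ ≤ ENNReal.ofReal (⌈S.toReal⌉₊ : ℕ) := ENNReal.ofReal_le_ofReal (Nat.le_ceil _)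
          _ = _ := ENNReal.ofReal_natCast _⟩
    refine ⟨1 / (2 * δ : ℝ), by positivity, 2 * α * s, fun n => ?_⟩
    -- pointwise bound `Dₙ(x) T(x,n)^ε ≤ Dₙ(x) · 2α(n+1) · ρ^{J(x)}`
    have hpt : ∀ x, Q.dist n x * ENNReal.ofReal ((T x n : ℝ) ^ (1 / (2 * δ : ℝ))) ≤
        Q.dist n x * (ENNReal.ofReal (2 * α * (n + 1) : ℝ) * ρ ^ Jf x n) := by
      intro x
      gcongr
      by_cases hex : ∃ j, A x n (2 ^ j) ≠ none
      · have hT : T x n = (searchPoly pF).eval (Wq.eval n + 2 ^ Jf x n) := if_pos hex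
        rw [hT, hρ, ← ENNReal.ofReal_pow (Real.sqrt_nonneg _), ← ENNReal.ofReal_mul (by positivity)]
        exact ENNReal.ofReal_le_ofReal (rpow_time_le hα hδ (hmono n (Jf x n)))
      · have hT : T x n = 0 := if_neg hex
        rw [hT, Nat.cast_zero, Real.zero_rpow (by positivity : (0 : ℝ) < 1 / (2 * δ)).ne']
        simp
    -- the tail probabilities of the first success index
    have htail : ∀ j : ℕ, (Q.dist n).toOuterMeasure {x | j + 1 ≤ Jf x n} ≤ (ENNReal.ofReal (1 / 2)) ^ j := by
      intro j
      have hsub : {x | j + 1 ≤ Jf x n} ∩ (Q.dist n).support ⊆ {x | A x n (2 ^ j) = none} := by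
        rintro x ⟨hjx, hx⟩
        have hex : ∃ j, A x n (2 ^ j) ≠ none := exists_ne_none_of_mem_support (hfail n) hx
        exact (hJf hex).1 j hjx
      refine ((Q.dist n).toOuterMeasure_mono hsub).trans ?_
      rw [← ENNReal.ofReal_pow (by norm_num), one_div_pow]
      refine toOuterMeasure_le_ofReal_of_prob_le Q.dist n (by positivity) ?_
      have := hfail n (2 ^ j) (pow_pos two_pos j)
      simpa using this
    calc ∑' x, Q.dist n x * ENNReal.ofReal ((T x n : ℝ) ^ (1 / (2 * δ : ℝ)))
        ≤ ∑' x, Q.dist n x * (ENNReal.ofReal (2 * α * (n + 1) : ℝ) * ρ ^ Jf x n) :=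
          ENNReal.tsum_le_tsum hpt
      _ = ENNReal.ofReal (2 * α * (n + 1) : ℝ) * ∑' x, Q.dist n x * ρ ^ Jf x n := by
          rw [← ENNReal.tsum_mul_left]
          refine tsum_congr fun x => ?_
          ring
      _ ≤ ENNReal.ofReal (2 * α * (n + 1) : ℝ) * S := by
          gcongr
          exact tsum_mul_pow_le_of_tail (Q.dist n) (fun x => Jf x n) ρ htail
      _ ≤ (2 * α * (n + 1) : ℕ) * (s : ℝ≥0∞) := by
          gcongr
          rw [← ENNReal.ofReal_natCast]
          exact ENNReal.ofReal_le_ofReal (by push_cast; exact le_rfl)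
      _ = ((2 * α * s * n + 2 * α * s : ℕ) : ℝ≥0∞) := by push_cast; ring

end Literature.Computability.MetaComplexity
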